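import Summits.QuantumFields.YangMills.Theorems.RenyiTelescopeUnitEventReduction
import Summits.QuantumFields.YangMills.Theorems.RenyiTelescopePlaquetteTransport

/-!
# Route `RenyiTelescope` — glue item `HistoryTailOfRenyiTelescope` (stmt-QuantumFields-27139): THE INSTANTIATION
# (support file; ideator seat `ym-r3-idea-2` g3, registered stub `stub_glueRest` of the glue skeleton v7)

THE STEP.  With the structural stubs of the glue landed — the conditional telescope, the plaquette-event transport, the unit-event reduction
(`HistoryTailL` from a unit-event tail schema), the abstract bootstrap (the induction on the cut-off), the interior complement, the telescoped
crux — the glue of LINE «RenyiTelescope» reduces to an INSTANTIATION: choose the constants and verify the bootstrap's five hypotheses from the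
two cruxes.  This file does exactly that (`stub_glueRest`), modulo ONE arithmetic input kept as a hypothesis (the registered stub
`stub_arithClosure`, pure real analysis, no measures): the existence of fine-regime cut-offs `J₀(d) ≥ 1` with `γ_d L^(J₀(d)) p(g_d)² ≤ η` (fine
regime of crux `FineRegimeUnitTailL` reaches `J₀(d)`), `Q L^(2J₀(d)) ≥ 3` (the telescope's orders `κ_d L^(2J) = 3L^(2J)/L^(2J₀(d)) ≤ QL^(2J)` are
admissible) and `p(g_d)⁴ L^(3(m+d)) ≤ L^(4J₀(d))` (the telescope's exponent is `≤ 4R₀`), for all depths `d ≥ h₀` — true because `p(g_d)` grows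
polynomially in `d` (e.g. `J₀(d) = d − ⌊d/8⌋`).
CONSTANTS: `ε(d) = C₊e^(−ac²p_d²)` (`C₊ = max(C,1)`), `Λ = 4R₀`, `B(d) = C'e^(−(ac²/2)p_d²)` with `C' = max(C₊, e^(4R₀)√(2C₊))`, `κ_d = 3/L^(2J₀(d))`,
`h₀ = max(h₁, h₂, h₃)` where `h₁` is the arithmetic threshold, `h₂` makes the bare tail `q(J+d) ≤ 1/4` (`bareTailAt`, summable ⇒ null), `h₃` makes
`A'·2^(−d) ≤ 1/4` (`A'` the constant of `perHeight_bound` for the envelope `B`: `Σ_h card(d+h)·B(d+h) ≤ A'2^(−d)·Σ_(h≥1)2^(−h)`).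
VERIFICATIONS: (env) algebra of `exp`/`rpow`; (fine) crux `FineRegimeUnitTailL` for `F.refine d` at `γ_d ≤ γ ≤ γ₁`; (tel) the telescoped crux with
`κ_d`; (compl) the interior complement for `F.refine d`, its bare term moved to `F` (`gibbsK_refine_real_not_plaqSmall`) and bounded by `bareTailAt`, its
level terms identified with the bootstrap's deeper unit events via `refine_refine` and bounded by the induction hypothesis, counted
(`card_unitPlaq_refine_le`) and summed (`half_pow_sum_Ico_le`).

WHAT THIS IS NOT: the two cruxes `CutoffRenyiL` (through the telescoped form) and `FineRegimeUnitTailL` are HYPOTHESES and stay open; the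
arithmetic closure is a hypothesis (registered stub); nothing here bears on the Yang–Mills mass gap and the rung R3 (`YM3TorusSU2`) is NOT proved.

References: T. Bałaban, CMP 102 (1985) 255–275 [Balaban1985UV3] ((7) p.257, (60) p.270, (71) p.273); C. King, CMP 103 (1986) 323–349 [King1986]
(Thm 3.4); J. Fröhlich, R. Israel, E. Lieb, B. Simon, CMP 62 (1978) 1–34 [FrohlichIsraelLiebSimon1978] (chessboard bound behind `bareTailAt`).
-/

noncomputable section

open MeasureTheory Filter
open Literature.MathematicalPhysics.QuantumFieldTheory.Balaban1983to89
open Literature.MathematicalPhysics.QuantumFieldTheory.Balaban1983to89.T3ContinuumYM3Torus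
open Literature.MathematicalPhysics.QuantumFieldTheory.Balaban1983to89.T3UnitScaleTilt
open Literature.MathematicalPhysics.QuantumFieldTheory.Balaban1983to89.T3UnitLawDensityEML
open Literature.MathematicalPhysics.QuantumFieldTheory.Balaban1983to89.T3InteriorExcision
open Literature.MathematicalPhysics.QuantumFieldTheory.Balaban1983to89.T3LevelShift
open Literature.MathematicalPhysics.QuantumFieldTheory.Balaban1983to89.T3ThresholdRemoval
open Literature.MathematicalPhysics.QuantumFieldTheory.Balaban1983to89.T3BareTailProfile
open Summit.QuantumFields.YangMills.Theorems.HistoryTailOfTwoSided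
open Summit.QuantumFields.YangMills.Theorems.LargeFieldMassRefinementTailOfHeightTail

namespace Summit.QuantumFields.YangMills.Theorems.RenyiTelescope

/-! ## §1 Small lemmas -/

/-- A null sequence is eventually `≤ 1/4`. [folklore] -/
theorem eventually_le_quarter {v : ℕ → ℝ} (hv : Tendsto v atTop (nhds 0)) : ∃ N : ℕ, ∀ n, N ≤ n → v n ≤ 1 / 4 := by
  obtain ⟨N, hN⟩ := eventually_atTop.mp (hv.eventually (eventually_le_nhds (by norm_num : (0 : ℝ) < 1 / 4)))
  exact ⟨N, hN⟩

/-- `Σ_(1 ≤ j < J) 2^(−(J−j)) ≤ 1`. [folklore] -/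
theorem half_pow_sum_Ico_le (J : ℕ) : ∑ j ∈ Finset.Ico 1 J, ((1 : ℝ) / 2) ^ (J - j) ≤ 1 := by
  induction J with
  | zero => simp
  | succ J ih =>
    rcases Nat.eq_zero_or_pos J with hJ | hJ
    · subst hJ
      simp
    · rw [Finset.sum_Ico_succ_top (by omega : 1 ≤ J), Nat.add_sub_cancel_left]
      have hrw : ∀ j ∈ Finset.Ico 1 J, ((1 : ℝ) / 2) ^ (J + 1 - j) = 1 / 2 * ((1 : ℝ) / 2) ^ (J - j) := by
        intro j hj
        rw [Finset.mem_Ico] at hj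
        rw [show J + 1 - j = (J - j) + 1 by omega, pow_succ]
        ring
      rw [Finset.sum_congr rfl hrw, ← Finset.mul_sum]
      linarith

/-- The bare finest-lattice large-field mass of run `J` of `F.refine d` (coupling `γL^(−d)`) is that of run `J + d` of `F`.
[cite: Balaban1985UV3, (1)-(3) p.256] -/
theorem gibbsK_refine_real_not_plaqSmall (F : T3Family) {γ : ℝ} (hγ : 0 ≤ γ) (b p : ℝ) (d J : ℕ) :
    (gibbsK (F.refine d) ℰp (γ * ((F.L : ℝ)⁻¹) ^ d) J).real {U | ¬ PlaqSmall (θBal F.L (γ * ((F.L : ℝ)⁻¹) ^ d) b p J) U} =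
      (gibbsK F ℰp γ (J + d)).real {U | ¬ PlaqSmall (θBal F.L γ b p (J + d)) U} := by
  have hS : MeasurableSet {U : GaugeField (F.P (J + d)) 0 (Matrix.specialUnitaryGroup (Fin 2) ℂ) |
      ¬ PlaqSmall (θBal F.L γ b p (J + d)) U} := (measurableSet_plaqSmall _).compl
  rw [gibbsK_real_eq_refine F ℰp hγ d J hS, θBal_mul_pow]
  congr 1
  ext U
  exact (not_congr (plaqSmall_fieldShift_iff F (sitesPerDir_refine_zero F d J) (θBal F.L γ b p (J + d)) U)).symm

/-! ## §2 The registered stub -/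

/-- **REGISTERED STUB `stub_glueRest` OF THE GLUE SKELETON v7 (item stmt-QuantumFields-27139)** — the instantiation: the telescoped crux
`CutoffRenyiL`, crux `FineRegimeUnitTailL`, the abstract bootstrap, the interior complement and the arithmetic closure give the unit-event tail schema
(hence, by `stub_unitEventReduction` and the transport, `HistoryTailL`). [cite: Balaban1985UV3, (7) p.257 and (71) p.273; King1986, Thm 3.4 p.334] -/
theorem stub_glueRest :
    (∀ (L : ℕ), ∃ (c b₁ p₁ : ℝ), 0 < c ∧ c ≤ 1 ∧ ∀ (b₀ p₀ : ℝ), b₁ ≤ b₀ → p₁ ≤ p₀ → 0 < b₀ → 2 < p₀ →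
      ∃ (γ₁ Q R₀ : ℝ), 0 < γ₁ ∧ γ₁ ≤ 1 ∧ 0 < Q ∧ 0 ≤ R₀ ∧ ∀ (F : T3Family) (γ : ℝ), F.L = L → 0 < γ → γ ≤ γ₁ →
        ∀ (d J₀ J : ℕ) (κ : ℝ) (p : Plaq ((F.refine d).P 0) 0), 1 ≤ J₀ → J₀ < J → 0 < κ → κ ≤ Q →
          3 ≤ κ * (F.L : ℝ) ^ (2 * J₀) →
          (∀ J', J₀ ≤ J' → J' ≤ J → 1 / 2 ≤ (gibbsK (F.refine d) ℰp (γ * ((F.L : ℝ)⁻¹) ^ d) J').real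
              (histGoodInt (F.refine d) (θBal F.L (γ * ((F.L : ℝ)⁻¹) ^ d) b₀ p₀) (θBal F.L (γ * ((F.L : ℝ)⁻¹) ^ d) (c * b₀) p₀ 1) J' 1)) →
          (gibbsK (F.refine d) ℰp (γ * ((F.L : ℝ)⁻¹) ^ d) J).real
              ((unitA (F.refine d) ℰp J) ⁻¹'
                {V | θBal F.L (γ * ((F.L : ℝ)⁻¹) ^ d) (c * b₀) p₀ 0 ≤ GaugeGroup.dist1 (GaugeField.plaqHol V p)} ∩
              histGoodInt (F.refine d) (θBal F.L (γ * ((F.L : ℝ)⁻¹) ^ d) b₀ p₀) (θBal F.L (γ * ((F.L : ℝ)⁻¹) ^ d) (c * b₀) p₀ 1) J 1) ≤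
            Real.exp (4 / 3 * R₀ * κ * (B10.pFun b₀ p₀ (Real.sqrt (γ * ((F.L : ℝ)⁻¹) ^ d))) ^ 4 * (F.L : ℝ) ^ (3 * (F.m + d)) /
                (F.L : ℝ) ^ (2 * J₀)) *
              ((gibbsK (F.refine d) ℰp (γ * ((F.L : ℝ)⁻¹) ^ d) J₀).real
                  ((unitA (F.refine d) ℰp J₀) ⁻¹'
                {V | θBal F.L (γ * ((F.L : ℝ)⁻¹) ^ d) (c * b₀) p₀ 0 ≤ GaugeGroup.dist1 (GaugeField.plaqHol V p)} ∩
              histGoodInt (F.refine d) (θBal F.L (γ * ((F.L : ℝ)⁻¹) ^ d) b₀ p₀) (θBal F.L (γ * ((F.L : ℝ)⁻¹) ^ d) (c * b₀) p₀ 1) J₀ 1) /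
                (gibbsK (F.refine d) ℰp (γ * ((F.L : ℝ)⁻¹) ^ d) J₀).real
                  (histGoodInt (F.refine d) (θBal F.L (γ * ((F.L : ℝ)⁻¹) ^ d) b₀ p₀) (θBal F.L (γ * ((F.L : ℝ)⁻¹) ^ d) (c * b₀) p₀ 1) J₀ 1)) ^ (1 / 2 : ℝ)) →
      Summit.QuantumFields.YangMills.Theses.RenyiTelescope.FineRegimeUnitTailL →
    (∀ (ι : ℕ → Type) (u : (d : ℕ) → ℕ → ι d → ℝ) (P : ℕ → ℕ → ℝ) (ε B : ℕ → ℝ) (J₀ : ℕ → ℕ) (Λ : ℝ) (h₀ : ℕ),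
      (∀ d, h₀ ≤ d → 1 ≤ J₀ d ∧ 0 ≤ ε d ∧ ε d ≤ B d ∧ Real.exp Λ * (2 * ε d) ^ (1 / 2 : ℝ) ≤ B d) →
      (∀ d J (p : ι d), h₀ ≤ d → 0 ≤ u d J p) →
      (∀ d J (p : ι d), h₀ ≤ d → 1 ≤ J → J ≤ J₀ d → u d J p ≤ ε d) →
      (∀ d J (p : ι d), h₀ ≤ d → J₀ d < J → (∀ J', J₀ d ≤ J' → J' ≤ J → 1 / 2 ≤ P d J') →
        u d J p ≤ Real.exp Λ * (u d (J₀ d) p / P d (J₀ d)) ^ (1 / 2 : ℝ)) →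
      (∀ d J, h₀ ≤ d → 1 ≤ J →
        (∀ h j (p' : ι (d + h)), 1 ≤ h → 1 ≤ j → j + h = J → u (d + h) j p' ≤ B (d + h)) → 1 / 2 ≤ P d J) →
      ∀ d J (p : ι d), h₀ ≤ d → 1 ≤ J → u d J p ≤ B d ∧ 1 / 2 ≤ P d J) →
    (∀ (F : T3Family) (γ b₀ c p₀ : ℝ) (J : ℕ), 0 < γ → γ ≤ 1 → 0 < b₀ → c ≤ 1 → 1 ≤ J →
    1 - (gibbsK F ℰp γ J).real (histGoodInt F (θBal F.L γ b₀ p₀) (θBal F.L γ (c * b₀) p₀ 1) J 1) ≤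
      (gibbsK F ℰp γ J).real {U | ¬ PlaqSmall (θBal F.L γ (c * b₀) p₀ J) U} +
        ∑ j ∈ Finset.Ico 1 J, ∑ p : Plaq ((F.refine (J - j)).P 0) 0,
          (gibbsK (F.refine (J - j)) ℰp (γ * ((F.L : ℝ)⁻¹) ^ (J - j)) j).real
            ((unitA (F.refine (J - j)) ℰp j) ⁻¹'
                {V | θBal F.L (γ * ((F.L : ℝ)⁻¹) ^ (J - j)) (c * b₀) p₀ 0 ≤ GaugeGroup.dist1 (GaugeField.plaqHol V p)} ∩
              histGoodInt (F.refine (J - j)) (θBal F.L (γ * ((F.L : ℝ)⁻¹) ^ (J - j)) b₀ p₀)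
                (θBal F.L (γ * ((F.L : ℝ)⁻¹) ^ (J - j)) (c * b₀) p₀ 1) j 1)) →
    (∀ (F : T3Family) (γ b₀ p₀ η Q : ℝ), 0 < γ → γ ≤ 1 → 0 < b₀ → 0 < p₀ → 0 < η → 0 < Q →
      ∃ (h₀ : ℕ) (J₀ : ℕ → ℕ), ∀ d, h₀ ≤ d →
        1 ≤ J₀ d ∧
        γ * ((F.L : ℝ)⁻¹) ^ d * (F.L : ℝ) ^ (J₀ d) * (B10.pFun b₀ p₀ (Real.sqrt (γ * ((F.L : ℝ)⁻¹) ^ d))) ^ 2 ≤ η ∧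
        3 ≤ Q * (F.L : ℝ) ^ (2 * J₀ d) ∧
        (B10.pFun b₀ p₀ (Real.sqrt (γ * ((F.L : ℝ)⁻¹) ^ d))) ^ 4 * (F.L : ℝ) ^ (3 * (F.m + d)) ≤ (F.L : ℝ) ^ (4 * J₀ d)) →
    (∀ (L : ℕ), ∃ (c b₁ p₁ : ℝ), 0 < c ∧ c ≤ 1 ∧ ∀ (b₀ p₀ : ℝ), b₁ ≤ b₀ → p₁ ≤ p₀ → 0 < b₀ → 2 < p₀ →
      ∃ γ₁ : ℝ, 0 < γ₁ ∧ γ₁ ≤ 1 ∧ ∀ (F : T3Family) (γ : ℝ), F.L = L → 0 < γ → γ ≤ γ₁ →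
        ∃ (h₀ : ℕ) (C a : ℝ), 0 ≤ C ∧ 0 < a ∧ ∀ (d J : ℕ) (p : Plaq ((F.refine d).P 0) 0), h₀ ≤ d → 1 ≤ J →
          (gibbsK (F.refine d) ℰp (γ * ((F.L : ℝ)⁻¹) ^ d) J).real
              ((unitA (F.refine d) ℰp J) ⁻¹'
                  {V | θBal F.L (γ * ((F.L : ℝ)⁻¹) ^ d) (c * b₀) p₀ 0 ≤ GaugeGroup.dist1 (GaugeField.plaqHol V p)} ∩
                histGoodInt (F.refine d) (θBal F.L (γ * ((F.L : ℝ)⁻¹) ^ d) b₀ p₀)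
                  (θBal F.L (γ * ((F.L : ℝ)⁻¹) ^ d) (c * b₀) p₀ 1) J 1) ≤
            C * Real.exp (-(a * (B10.pFun b₀ p₀ (Real.sqrt (γ * ((F.L : ℝ)⁻¹) ^ d))) ^ 2))) := by
  intro hK hFi hB hI hA L
  obtain ⟨c, b₁, p₁, hc, hc1, hK1⟩ := hK L
  obtain ⟨b₁', p₁', hF1⟩ := hFi L c hc hc1
  refine ⟨c, max b₁ b₁', max p₁ p₁', hc, hc1, fun b₀ p₀ hb hp hb₀ hp₀ => ?_⟩
  obtain ⟨γ₁, Q, R₀, hγ₁, hγ₁1, hQ, hR₀, hK2⟩ := hK1 b₀ p₀ ((le_max_left _ _).trans hb) ((le_max_left _ _).trans hp) hb₀ hp₀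
  obtain ⟨γ₁', η, a, C, hγ₁', -, hη, ha, hF2⟩ := hF1 b₀ p₀ ((le_max_right _ _).trans hb) ((le_max_right _ _).trans hp) hb₀ hp₀
  refine ⟨min γ₁ γ₁', lt_min hγ₁ hγ₁', (min_le_left _ _).trans hγ₁1, fun F γ hFL hγ hγle => ?_⟩
  have hγ1 : γ ≤ γ₁ := hγle.trans (min_le_left _ _)
  have hγ1' : γ ≤ γ₁' := hγle.trans (min_le_right _ _)
  have hγone : γ ≤ 1 := hγ1.trans hγ₁1
  subst hFL
  have hL1 : (1 : ℝ) ≤ F.L := by exact_mod_cast F.hL.2.le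
  have hp₀one : 1 ≤ p₀ := by linarith
  have hC0 : 0 ≤ max C 1 := zero_le_one.trans (le_max_right _ _)
  have hC'0 : 0 ≤ max (max C 1) (Real.exp (4 * R₀) * Real.sqrt (2 * max C 1)) := hC0.trans (le_max_left _ _)
  have ha' : 0 < a * c ^ 2 / 2 := by positivity
  -- depth-dependent coupling facts
  have hγd : ∀ d : ℕ, 0 < (γ * ((F.L : ℝ)⁻¹) ^ d) := fun d => mul_pos hγ (pow_pos (inv_pos.mpr (by positivity)) _)
  have hγdle : ∀ d : ℕ, (γ * ((F.L : ℝ)⁻¹) ^ d) ≤ γ := fun d =>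
    mul_le_of_le_one_right hγ.le (pow_le_one₀ (inv_nonneg.mpr (by positivity)) (inv_le_one_of_one_le₀ hL1))
  -- the arithmetic closure
  obtain ⟨h₁, J₀, hA1⟩ := hA F γ b₀ p₀ η Q hγ hγone hb₀ (by linarith) hη hQ
  -- the bare tail of `F` at the profile `(c·b₀, p₀)`, eventually `≤ 1/4`
  obtain ⟨q, -, hqs, -, hbare⟩ := bareTailAt F hγ hγone (mul_pos hc hb₀) hp₀one
  obtain ⟨h₂, hh₂⟩ := eventually_le_quarter hqs.tendsto_atTop_zero
  -- the height profile of the envelope `B(d) = C'·exp(−(ac²/2)p_d²)`, eventually `≤ 1/4`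
  obtain ⟨A', hA'0, hPH⟩ := exists_perHeight_bound F hγ hγone hb₀ hp₀one hC'0 0 ha'
  obtain ⟨h₃, hh₃⟩ := eventually_le_quarter (v := fun d : ℕ => A' * ((1 : ℝ) / 2) ^ d)
    (by simpa using tendsto_const_nhds.mul (tendsto_pow_atTop_nhds_zero_of_lt_one (by norm_num : (0 : ℝ) ≤ 1 / 2) (by norm_num)))
  refine ⟨max h₁ (max h₂ h₃), max (max C 1) (Real.exp (4 * R₀) * Real.sqrt (2 * max C 1)), a * c ^ 2 / 2, hC'0, ha', ?_⟩
  have hd₁ : ∀ d : ℕ, max h₁ (max h₂ h₃) ≤ d → h₁ ≤ d := fun d hd => (le_max_left _ _).trans hd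
  have hd₂ : ∀ d : ℕ, max h₁ (max h₂ h₃) ≤ d → h₂ ≤ d := fun d hd => ((le_max_left _ _).trans (le_max_right _ _)).trans hd
  have hd₃ : ∀ d : ℕ, max h₁ (max h₂ h₃) ≤ d → h₃ ≤ d := fun d hd => ((le_max_right _ _).trans (le_max_right _ _)).trans hd
  /- (env) the envelopes -/
  have henv : ∀ d : ℕ, max h₁ (max h₂ h₃) ≤ d → 1 ≤ J₀ d ∧ 0 ≤ max C 1 * Real.exp (-(a * c ^ 2 * (B10.pFun b₀ p₀ (Real.sqrt (γ * ((F.L : ℝ)⁻¹) ^ d))) ^ 2)) ∧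
      max C 1 * Real.exp (-(a * c ^ 2 * (B10.pFun b₀ p₀ (Real.sqrt (γ * ((F.L : ℝ)⁻¹) ^ d))) ^ 2)) ≤ max (max C 1) (Real.exp (4 * R₀) * Real.sqrt (2 * max C 1)) * Real.exp (-(a * c ^ 2 / 2 * (B10.pFun b₀ p₀ (Real.sqrt (γ * ((F.L : ℝ)⁻¹) ^ d))) ^ 2)) ∧
      Real.exp (4 * R₀) * (2 * (max C 1 * Real.exp (-(a * c ^ 2 * (B10.pFun b₀ p₀ (Real.sqrt (γ * ((F.L : ℝ)⁻¹) ^ d))) ^ 2)))) ^ (1 / 2 : ℝ) ≤ max (max C 1) (Real.exp (4 * R₀) * Real.sqrt (2 * max C 1)) * Real.exp (-(a * c ^ 2 / 2 * (B10.pFun b₀ p₀ (Real.sqrt (γ * ((F.L : ℝ)⁻¹) ^ d))) ^ 2)) := by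
    intro d hd
    obtain ⟨hJ1, -, -, -⟩ := hA1 d (hd₁ d hd)
    have hx : 0 ≤ a * c ^ 2 / 2 * (B10.pFun b₀ p₀ (Real.sqrt (γ * ((F.L : ℝ)⁻¹) ^ d))) ^ 2 := by positivity
    refine ⟨hJ1, by positivity, ?_, ?_⟩
    · refine mul_le_mul (le_max_left _ _) (Real.exp_le_exp.mpr (by linarith)) (Real.exp_nonneg _) hC'0
    · have h2C : 0 ≤ 2 * max C 1 := by positivity
      have e1 : 2 * (max C 1 * Real.exp (-(a * c ^ 2 * (B10.pFun b₀ p₀ (Real.sqrt (γ * ((F.L : ℝ)⁻¹) ^ d))) ^ 2))) = (2 * max C 1) * Real.exp (-(a * c ^ 2 * (B10.pFun b₀ p₀ (Real.sqrt (γ * ((F.L : ℝ)⁻¹) ^ d))) ^ 2)) := by ring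
      have e2 : -(a * c ^ 2 * (B10.pFun b₀ p₀ (Real.sqrt (γ * ((F.L : ℝ)⁻¹) ^ d))) ^ 2) * (1 / 2 : ℝ) = -(a * c ^ 2 / 2 * (B10.pFun b₀ p₀ (Real.sqrt (γ * ((F.L : ℝ)⁻¹) ^ d))) ^ 2) := by ring
      rw [e1, Real.mul_rpow h2C (Real.exp_nonneg _), ← Real.sqrt_eq_rpow, ← Real.exp_mul, e2, ← mul_assoc]
      exact mul_le_mul_of_nonneg_right (le_max_right _ _) (Real.exp_nonneg _)
  /- (u ≥ 0) -/
  have hu0 : ∀ (d J : ℕ) (p : Plaq ((F.refine d).P 0) 0), max h₁ (max h₂ h₃) ≤ d → 0 ≤ (gibbsK (F.refine d) ℰp (γ * ((F.L : ℝ)⁻¹) ^ d) J).real ((unitA (F.refine d) ℰp J) ⁻¹' {V | θBal F.L (γ * ((F.L : ℝ)⁻¹) ^ d) (c * b₀) p₀ 0 ≤ GaugeGroup.dist1 (GaugeField.plaqHol V p)} ∩ histGoodInt (F.refine d) (θBal F.L (γ * ((F.L : ℝ)⁻¹) ^ d) b₀ p₀) (θBal F.L (γ * ((F.L : ℝ)⁻¹)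 ^ d) (c * b₀) p₀ 1) J 1) :=
    fun d J p _ => measureReal_nonneg
  /- (fine) crux `FineRegimeUnitTailL` below `J₀(d)` -/
  have hfine : ∀ (d J : ℕ) (p : Plaq ((F.refine d).P 0) 0), max h₁ (max h₂ h₃) ≤ d → 1 ≤ J → J ≤ J₀ d →
      (gibbsK (F.refine d) ℰp (γ * ((F.L : ℝ)⁻¹) ^ d) J).real ((unitA (F.refine d) ℰp J) ⁻¹' {V | θBal F.L (γ * ((F.L : ℝ)⁻¹) ^ d) (c * b₀) p₀ 0 ≤ GaugeGroup.dist1 (GaugeField.plaqHol V p)} ∩ histGoodInt (F.refine d) (θBal F.L (γ * ((F.L : ℝ)⁻¹) ^ d) b₀ p₀) (θBal F.L (γ * ((F.L : ℝ)⁻¹) ^ d) (c * b₀) p₀ 1) J 1) ≤ max C 1 * Real.exp (-(a * c ^ 2 * (B10.pFun b₀ p₀ (Real.sqrt (γ * ((F.L : ℝ)⁻¹) ^ d))) ^ 2)) := by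
    intro d J p hd hJ hJJ
    obtain ⟨-, hfr, -, -⟩ := hA1 d (hd₁ d hd)
    have hreg : (γ * ((F.L : ℝ)⁻¹) ^ d) * (F.L : ℝ) ^ J * (B10.pFun b₀ p₀ (Real.sqrt (γ * ((F.L : ℝ)⁻¹) ^ d))) ^ 2 ≤ η :=
      (mul_le_mul_of_nonneg_right (mul_le_mul_of_nonneg_left (pow_le_pow_right₀ hL1 hJJ) (hγd d).le) (sq_nonneg _)).trans hfr
    have h38 := hF2 (F.refine d) (γ * ((F.L : ℝ)⁻¹) ^ d) rfl (hγd d) ((hγdle d).trans hγ1') J p hJ hreg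
    exact h38.trans (mul_le_mul_of_nonneg_right (le_max_left _ _) (Real.exp_nonneg _))
  /- (tel) the telescoped crux with `κ_d = 3/L^(2J₀(d))` -/
  have htel : ∀ (d J : ℕ) (p : Plaq ((F.refine d).P 0) 0), max h₁ (max h₂ h₃) ≤ d → J₀ d < J →
      (∀ J', J₀ d ≤ J' → J' ≤ J → 1 / 2 ≤ (gibbsK (F.refine d) ℰp (γ * ((F.L : ℝ)⁻¹) ^ d) J').real (histGoodInt (F.refine d) (θBal F.L (γ * ((F.L : ℝ)⁻¹) ^ d) b₀ p₀) (θBal F.L (γ * ((F.L : ℝ)⁻¹) ^ d) (c * b₀) p₀ 1) J' 1)) →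
      (gibbsK (F.refine d) ℰp (γ * ((F.L : ℝ)⁻¹) ^ d) J).real ((unitA (F.refine d) ℰp J) ⁻¹' {V | θBal F.L (γ * ((F.L : ℝ)⁻¹) ^ d) (c * b₀) p₀ 0 ≤ GaugeGroup.dist1 (GaugeField.plaqHol V p)} ∩ histGoodInt (F.refine d) (θBal F.L (γ * ((F.L : ℝ)⁻¹) ^ d) b₀ p₀) (θBal F.L (γ * ((F.L : ℝ)⁻¹) ^ d) (c * b₀) p₀ 1) J 1) ≤ Real.exp (4 * R₀) * ((gibbsK (F.refine d) ℰp (γ * ((F.L : ℝ)⁻¹) ^ d) (J₀ d)).real ((unitA (F.refine d) ℰp (J₀ d)) ⁻¹' {V | θBal F.L (γ * ((F.L : ℝ)⁻¹) ^ d) (c * b₀) p₀ 0 ≤ GaugeGroup.dist1 (GaugeField.plaqHol V p)} ∩ histGoodInt (F.refine d) (θBal F.L (γ * ((F.L : ℝ)⁻¹) ^ d) b₀ p₀) (θBal F.L (γ * ((F.L : ℝ)⁻¹) ^ d) (c * b₀) p₀ 1) (J₀ d) 1) / (gibbsK (F.refine d) ℰp (γ * ((F.L : ℝ)⁻¹)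 ^ d) (J₀ d)).real (histGoodInt (F.refine d) (θBal F.L (γ * ((F.L : ℝ)⁻¹) ^ d) b₀ p₀) (θBal F.L (γ * ((F.L : ℝ)⁻¹) ^ d) (c * b₀) p₀ 1) (J₀ d) 1)) ^ (1 / 2 : ℝ) := by
    intro d J p hd hJ hpos
    obtain ⟨hJ1, -, hQ3, hP4⟩ := hA1 d (hd₁ d hd)
    have hX : 0 < (F.L : ℝ) ^ (2 * J₀ d) := by positivity
    have hκ : 0 < 3 / (F.L : ℝ) ^ (2 * J₀ d) := by positivity
    have hκQ : 3 / (F.L : ℝ) ^ (2 * J₀ d) ≤ Q := by rw [div_le_iff₀ hX]; exact hQ3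
    have hκ3 : 3 ≤ 3 / (F.L : ℝ) ^ (2 * J₀ d) * (F.L : ℝ) ^ (2 * J₀ d) := by rw [div_mul_cancel₀ _ hX.ne']
    have hk := hK2 F γ rfl hγ hγ1 d (J₀ d) J (3 / (F.L : ℝ) ^ (2 * J₀ d)) p hJ1 hJ hκ hκQ hκ3 hpos
    refine hk.trans (mul_le_mul_of_nonneg_right (Real.exp_le_exp.mpr ?_)
      (Real.rpow_nonneg (div_nonneg measureReal_nonneg measureReal_nonneg) _))
    have hW : (B10.pFun b₀ p₀ (Real.sqrt (γ * ((F.L : ℝ)⁻¹) ^ d))) ^ 4 * (F.L : ℝ) ^ (3 * (F.m + d)) / ((F.L : ℝ) ^ (2 * J₀ d) * (F.L : ℝ) ^ (2 * J₀ d)) ≤ 1 := by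
      rw [div_le_one (by positivity), ← pow_add, show 2 * J₀ d + 2 * J₀ d = 4 * J₀ d by ring]
      exact hP4
    have e : 4 / 3 * R₀ * (3 / (F.L : ℝ) ^ (2 * J₀ d)) * (B10.pFun b₀ p₀ (Real.sqrt (γ * ((F.L : ℝ)⁻¹) ^ d))) ^ 4 * (F.L : ℝ) ^ (3 * (F.m + d)) /
        (F.L : ℝ) ^ (2 * J₀ d) =
        4 * R₀ * ((B10.pFun b₀ p₀ (Real.sqrt (γ * ((F.L : ℝ)⁻¹) ^ d))) ^ 4 * (F.L : ℝ) ^ (3 * (F.m + d)) / ((F.L : ℝ) ^ (2 * J₀ d) * (F.L : ℝ) ^ (2 * J₀ d))) := by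
      field_simp
    rw [e]
    exact mul_le_of_le_one_right (by positivity) hW
  /- (compl) the interior complement: bare term + deeper unit events -/
  have hcmp : ∀ (d J : ℕ), max h₁ (max h₂ h₃) ≤ d → 1 ≤ J →
      (∀ (h j : ℕ) (p' : Plaq ((F.refine (d + h)).P 0) 0), 1 ≤ h → 1 ≤ j → j + h = J →
        (gibbsK (F.refine (d + h)) ℰp (γ * ((F.L : ℝ)⁻¹) ^ (d + h)) j).real ((unitA (F.refine (d + h)) ℰp j) ⁻¹' {V | θBal F.L (γ * ((F.L : ℝ)⁻¹) ^ (d + h)) (c * b₀) p₀ 0 ≤ GaugeGroup.dist1 (GaugeField.plaqHol V p')} ∩ histGoodInt (F.refine (d + h)) (θBal F.L (γ * ((F.L : ℝ)⁻¹) ^ (d + h)) b₀ p₀) (θBal F.L (γ * ((F.L : ℝ)⁻¹) ^ (d + h)) (c * b₀) p₀ 1) j 1) ≤ max (max C 1) (Real.exp (4 * R₀) * Real.sqrt (2 * max C 1)) * Real.exp (-(a * c ^ 2 / 2 * (B10.pFun b₀ p₀ (Real.sqrt (γ * ((F.L : ℝ)⁻¹) ^ (d + h)))) ^ 2))) →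
      1 / 2 ≤ (gibbsK (F.refine d) ℰp (γ * ((F.L : ℝ)⁻¹) ^ d) J).real (histGoodInt (F.refine d) (θBal F.L (γ * ((F.L : ℝ)⁻¹) ^ d) b₀ p₀) (θBal F.L (γ * ((F.L : ℝ)⁻¹) ^ d) (c * b₀) p₀ 1) J 1) := by
    intro d J hd hJ hdeep
    have hic := hI (F.refine d) (γ * ((F.L : ℝ)⁻¹) ^ d) b₀ c p₀ J (hγd d) ((hγdle d).trans hγone) hb₀ hc1 hJ
    simp only [T3Family.refine_L] at hic
    -- the bare term
    have hb' : (gibbsK (F.refine d) ℰp (γ * ((F.L : ℝ)⁻¹) ^ d) J).real {U | ¬ PlaqSmall (θBal F.L (γ * ((F.L : ℝ)⁻¹) ^ d) (c * b₀) p₀ J) U} ≤ 1 / 4 := by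
      rw [gibbsK_refine_real_not_plaqSmall F hγ.le (c * b₀) p₀ d J]
      exact (hbare (J + d)).trans (hh₂ (J + d) (by have := hd₂ d hd; omega))
    -- the level terms
    have hterm : ∀ j ∈ Finset.Ico 1 J,
        ∑ p' : Plaq (((F.refine d).refine (J - j)).P 0) 0, (gibbsK ((F.refine d).refine (J - j)) ℰp ((γ * ((F.L : ℝ)⁻¹) ^ d) * ((F.L : ℝ)⁻¹) ^ (J - j)) j).real ((unitA ((F.refine d).refine (J - j)) ℰp j) ⁻¹' {V | θBal F.L ((γ * ((F.L : ℝ)⁻¹) ^ d) * ((F.L : ℝ)⁻¹) ^ (J - j)) (c * b₀) p₀ 0 ≤ GaugeGroup.dist1 (GaugeField.plaqHol V p')} ∩ histGoodInt ((F.refine d).refine (J - j)) (θBal F.L ((γ * ((F.L : ℝ)⁻¹) ^ d) * ((F.L : ℝ)⁻¹) ^ (J - j)) b₀ p₀) (θBal F.L ((γ * ((F.L : ℝ)⁻¹) ^ d) * ((F.L : ℝ)⁻¹) ^ (J - j)) (c * b₀) p₀ 1) j 1) ≤ A' * ((1 : ℝ) / 2) ^ (d + (J - j)) := by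
      intro j hj
      rw [Finset.mem_Ico] at hj
      have eγ : (γ * ((F.L : ℝ)⁻¹) ^ d) * ((F.L : ℝ)⁻¹) ^ (J - j) = (γ * ((F.L : ℝ)⁻¹) ^ (d + (J - j))) := by rw [mul_assoc, ← pow_add]
      rw [refine_refine F d (J - j)]
      simp only [eγ]
      have hP' := hPH (d + (J - j))
      rw [pow_zero, mul_one] at hP'
      calc ∑ p' : Plaq ((F.refine (d + (J - j))).P 0) 0, (gibbsK (F.refine (d + (J - j))) ℰp (γ * ((F.L : ℝ)⁻¹) ^ (d + (J - j))) j).real ((unitA (F.refine (d + (J - j))) ℰp j) ⁻¹' {V | θBal F.L (γ * ((F.L : ℝ)⁻¹) ^ (d + (J - j))) (c * b₀) p₀ 0 ≤ GaugeGroup.dist1 (GaugeField.plaqHol V p')} ∩ histGoodInt (F.refine (d + (J - j))) (θBal F.L (γ * ((F.L : ℝ)⁻¹) ^ (d + (J - j))) b₀ p₀) (θBal F.L (γ * ((F.L : ℝ)⁻¹) ^ (d + (J - j))) (c * b₀) p₀ 1) j 1)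
          ≤ ∑ p' : Plaq ((F.refine (d + (J - j))).P 0) 0, max (max C 1) (Real.exp (4 * R₀) * Real.sqrt (2 * max C 1)) * Real.exp (-(a * c ^ 2 / 2 * (B10.pFun b₀ p₀ (Real.sqrt (γ * ((F.L : ℝ)⁻¹) ^ (d + (J - j))))) ^ 2)) :=
            Finset.sum_le_sum fun p' _ => hdeep (J - j) j p' (by omega) hj.1 (by omega)
        _ = (Fintype.card (Plaq ((F.refine (d + (J - j))).P 0) 0) : ℝ) * (max (max C 1) (Real.exp (4 * R₀) * Real.sqrt (2 * max C 1)) * Real.exp (-(a * c ^ 2 / 2 * (B10.pFun b₀ p₀ (Real.sqrt (γ * ((F.L : ℝ)⁻¹) ^ (d + (J - j))))) ^ 2))) := by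
            rw [Finset.sum_const, Finset.card_univ, nsmul_eq_mul]
        _ ≤ 9 * (8 * (F.L : ℝ) ^ (3 * F.m) * ((F.L : ℝ) ^ (d + (J - j))) ^ 3) * (max (max C 1) (Real.exp (4 * R₀) * Real.sqrt (2 * max C 1)) * Real.exp (-(a * c ^ 2 / 2 * (B10.pFun b₀ p₀ (Real.sqrt (γ * ((F.L : ℝ)⁻¹) ^ (d + (J - j))))) ^ 2))) :=
            mul_le_mul_of_nonneg_right (card_unitPlaq_refine_le F (d + (J - j)) j) (mul_nonneg hC'0 (Real.exp_nonneg _))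
        _ ≤ A' * ((1 : ℝ) / 2) ^ (d + (J - j)) := hP'
    have hsum : ∑ j ∈ Finset.Ico 1 J, ∑ p' : Plaq (((F.refine d).refine (J - j)).P 0) 0, (gibbsK ((F.refine d).refine (J - j)) ℰp ((γ * ((F.L : ℝ)⁻¹) ^ d) * ((F.L : ℝ)⁻¹) ^ (J - j)) j).real ((unitA ((F.refine d).refine (J - j)) ℰp j) ⁻¹' {V | θBal F.L ((γ * ((F.L : ℝ)⁻¹) ^ d) * ((F.L : ℝ)⁻¹) ^ (J - j)) (c * b₀) p₀ 0 ≤ GaugeGroup.dist1 (GaugeField.plaqHol V p')} ∩ histGoodInt ((F.refine d).refine (J - j)) (θBal F.L ((γ * ((F.L : ℝ)⁻¹) ^ d) * ((F.L : ℝ)⁻¹) ^ (J - j)) b₀ p₀) (θBal F.L ((γ * ((F.L : ℝ)⁻¹) ^ d) * ((F.L : ℝ)⁻¹) ^ (J - j)) (c * b₀) p₀ 1) j 1) ≤ A' * ((1 : ℝ) / 2) ^ d := by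
      calc ∑ j ∈ Finset.Ico 1 J, ∑ p' : Plaq (((F.refine d).refine (J - j)).P 0) 0, (gibbsK ((F.refine d).refine (J - j)) ℰp ((γ * ((F.L : ℝ)⁻¹) ^ d) * ((F.L : ℝ)⁻¹) ^ (J - j)) j).real ((unitA ((F.refine d).refine (J - j)) ℰp j) ⁻¹' {V | θBal F.L ((γ * ((F.L : ℝ)⁻¹) ^ d) * ((F.L : ℝ)⁻¹) ^ (J - j)) (c * b₀) p₀ 0 ≤ GaugeGroup.dist1 (GaugeField.plaqHol V p')} ∩ histGoodInt ((F.refine d).refine (J - j)) (θBal F.L ((γ * ((F.L : ℝ)⁻¹) ^ d) * ((F.L : ℝ)⁻¹) ^ (J - j)) b₀ p₀) (θBal F.L ((γ * ((F.L : ℝ)⁻¹) ^ d) * ((F.L : ℝ)⁻¹) ^ (J - j)) (c * b₀) p₀ 1) j 1)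
          ≤ ∑ j ∈ Finset.Ico 1 J, A' * ((1 : ℝ) / 2) ^ (d + (J - j)) := Finset.sum_le_sum hterm
        _ = A' * ((1 : ℝ) / 2) ^ d * ∑ j ∈ Finset.Ico 1 J, ((1 : ℝ) / 2) ^ (J - j) := by
            rw [Finset.mul_sum]
            exact Finset.sum_congr rfl fun j _ => by rw [pow_add]; ring
        _ ≤ A' * ((1 : ℝ) / 2) ^ d * 1 := mul_le_mul_of_nonneg_left (half_pow_sum_Ico_le J) (by positivity)
        _ = A' * ((1 : ℝ) / 2) ^ d := mul_one _
    have h4 := hh₃ d (hd₃ d hd)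
    linarith
  -- THE BOOTSTRAP
  have key := hB (fun d => Plaq ((F.refine d).P 0) 0)
    (fun d J p => (gibbsK (F.refine d) ℰp (γ * ((F.L : ℝ)⁻¹) ^ d) J).real ((unitA (F.refine d) ℰp J) ⁻¹' {V | θBal F.L (γ * ((F.L : ℝ)⁻¹) ^ d) (c * b₀) p₀ 0 ≤ GaugeGroup.dist1 (GaugeField.plaqHol V p)} ∩ histGoodInt (F.refine d) (θBal F.L (γ * ((F.L : ℝ)⁻¹) ^ d) b₀ p₀) (θBal F.L (γ * ((F.L : ℝ)⁻¹) ^ d) (c * b₀) p₀ 1) J 1))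
    (fun d J => (gibbsK (F.refine d) ℰp (γ * ((F.L : ℝ)⁻¹) ^ d) J).real (histGoodInt (F.refine d) (θBal F.L (γ * ((F.L : ℝ)⁻¹) ^ d) b₀ p₀) (θBal F.L (γ * ((F.L : ℝ)⁻¹) ^ d) (c * b₀) p₀ 1) J 1))
    (fun d => max C 1 * Real.exp (-(a * c ^ 2 * (B10.pFun b₀ p₀ (Real.sqrt (γ * ((F.L : ℝ)⁻¹) ^ d))) ^ 2)))
    (fun d => max (max C 1) (Real.exp (4 * R₀) * Real.sqrt (2 * max C 1)) * Real.exp (-(a * c ^ 2 / 2 * (B10.pFun b₀ p₀ (Real.sqrt (γ * ((F.L : ℝ)⁻¹) ^ d))) ^ 2)))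
    J₀ (4 * R₀) (max h₁ (max h₂ h₃)) henv hu0 hfine htel hcmp
  exact fun d J p hd hJ => (key d J p hd hJ).1

end Summit.QuantumFields.YangMills.Theorems.RenyiTelescope

end
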